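import Summits.QuantumFields.YangMills.Theorems.ConvexGribovBodyContinuumLegGivenGapCsclConstants
import HarnessLib

/-!
# `ContinuumLegGivenGap` (stmt-QuantumFields-15828), line `Sketch`, reshape 17-CS, helper 8 of `stub_csclOfLock`:
# the per-step budget (constants, length threshold, choice of the torus in the admissible set) and the scheme

* `cscl_coordBound` — a local observable has support edges with bounded coordinates;
* `cscl_budget` — at ONE index of the locked datum (coupling `β'`, rate `M > 0`, threshold `S₁'`), for the class box
  `Λ = {e : |e.1 j| ≤ R, 1 ≤ e.1 0}` and its reflection `Λθ`, a sup bound `Bb` and a tolerance `εk > 0`, there are a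
  torus half-side `L` in any cofinal admissible set, a shift range `Nn ≥ Nmin` and a constant `D > 0` with
  `2R + Nn + 10 ≤ L`, `D e^{M} ≤ εk e^{M Nn/2}`, and the reflected connected self-correlation of EVERY complex
  observable with real local parts supported on `Λ` (reflections on `Λθ`) and bounded by `Bb` is `≤ D e^{−Mn}`
  (`n ≤ S`, `S ≥ S₁'`) — the hypotheses of `cscl_torus_pair`, uniformly over the class (Banach–Steinhaus, `cscl_bs`);
* `cscl_tendsto_mul_of_pow` — `a_k L_k → ∞` from `a_k⁻¹ ≤ (a_k L_k)^N` and `a_k → 0`;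
* `cscl_mkScheme` — the canonically normalised, exactly centred scheme with prescribed `a, β, L`.
Registered anchor: `cscl_anchor_scheme`. No definitions. [folklore]
-/

noncomputable section

open scoped ComplexConjugate
open MeasureTheory Filter Topology
open Literature.MathematicalPhysics.QuantumFieldTheory Literature.MathematicalPhysics.QuantumLattice
open Literature.Probability.LatticeModels (box mem_box)
open Summit.QuantumFields.YangMills.Theorems.ClusteringToYangMills.Reconstructible

namespace Summit.QuantumFields.YangMills.Theorems.ContinuumLegGivenGap

section Budget

variable {G : Type} [Group G] [TopologicalSpace G] [IsTopologicalGroup G] [CompactSpace G]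
  [MeasurableSpace G] [BorelSpace G] (r : LatticeRep G)

omit [TopologicalSpace G] [IsTopologicalGroup G] [CompactSpace G] [BorelSpace G] in
/-- The support edges of a local observable have bounded coordinates. [folklore] -/
theorem cscl_coordBound (P : YMSpecies G) : ∃ Rc : ℕ, ∀ e ∈ P.supp, ∀ j : Fin 4, |e.1 j| ≤ Rc := by
  classical
  refine ⟨P.supp.sup fun e => Finset.univ.sup fun j => (e.1 j).natAbs, fun e he j => ?_⟩
  have h1 : (e.1 j).natAbs ≤ Finset.univ.sup fun j => (e.1 j).natAbs := Finset.le_sup (f := fun j => (e.1 j).natAbs) (Finset.mem_univ j)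
  have h2 : (Finset.univ.sup fun j => (e.1 j).natAbs) ≤ P.supp.sup fun e => Finset.univ.sup fun j => (e.1 j).natAbs :=
    Finset.le_sup (f := fun e => Finset.univ.sup fun j => (e.1 j).natAbs) he
  have h3 : ((e.1 j).natAbs : ℤ) ≤ ((P.supp.sup fun e => Finset.univ.sup fun j => (e.1 j).natAbs : ℕ) : ℤ) := by
    exact_mod_cast h1.trans h2
  rw [← Int.natCast_natAbs]
  exact h3

/-- **The per-step budget** (see the module docstring). [folklore] -/
theorem cscl_budget {β' M : ℝ} {S₁' : ℕ} (hM : 0 < M)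
    (hlock : ∀ A B : YMSpecies G, ∃ C : ℝ, ∀ S n : ℕ, S₁' ≤ S → n ≤ S →
      |latticeConnectedCorr r.ρ β' (2 * S + 1) A.F B.F n| ≤ C * Real.exp (-(M * n)))
    (R Nmin : ℕ) {Bb εk : ℝ} (hBb : 0 ≤ Bb) (hεk : 0 < εk) {𝓛set : Set ℕ} (hcof : ∀ S : ℕ, ∃ S' : ℕ, S' ∈ 𝓛set ∧ S ≤ S') :
    ∃ L : ℕ, L ∈ 𝓛set ∧ ∃ (Nn : ℕ) (D : ℝ), Nmin ≤ Nn ∧ 2 * R + Nn + 10 ≤ L ∧ 0 < D ∧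
      D * Real.exp M ≤ εk * Real.exp (M * Nn / 2) ∧
      ∀ (O₁ O₂ O₁' O₂' : YMSpecies G),
        O₁.supp = ((box 4 R).filter fun y => 1 ≤ y 0) ×ˢ (Finset.univ : Finset (Fin 4)) →
        O₂.supp = ((box 4 R).filter fun y => 1 ≤ y 0) ×ˢ (Finset.univ : Finset (Fin 4)) →
        O₁'.supp = (((box 4 R).filter fun y => 1 ≤ y 0) ×ˢ (Finset.univ : Finset (Fin 4))).image
          (fun e => if e.2 = 0 then (latticeTimeReflection 4 (e.1 + Pi.single 0 1), 0)
            else (latticeTimeReflection 4 e.1, e.2)) →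
        O₂'.supp = (((box 4 R).filter fun y => 1 ≤ y 0) ×ˢ (Finset.univ : Finset (Fin 4))).image
          (fun e => if e.2 = 0 then (latticeTimeReflection 4 (e.1 + Pi.single 0 1), 0)
            else (latticeTimeReflection 4 e.1, e.2)) →
        O₁'.F = O₁.F ∘ gaugeTimeReflect → O₂'.F = O₂.F ∘ gaugeTimeReflect →
        (∀ U, |O₁.F U| ≤ Bb) → (∀ U, |O₂.F U| ≤ Bb) →
        ∀ S : ℕ, S₁' ≤ S → ∀ n : ℕ, n ≤ S →
          ‖(∫ U, conj ((O₁.F (gaugeTimeReflect (torusLift (2 * S + 1) U)) : ℂ) +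
                  Complex.I * (O₂.F (gaugeTimeReflect (torusLift (2 * S + 1) U)) : ℂ)) *
                ((O₁.F (configShift (-(Pi.single 0 (n : ℤ))) (torusLift (2 * S + 1) U)) : ℂ) +
                  Complex.I * (O₂.F (configShift (-(Pi.single 0 (n : ℤ))) (torusLift (2 * S + 1) U)) : ℂ))
                ∂(wilsonMeasure (d := 4) (L := 2 * S + 1) r.ρ β')) -
              conj (∫ V, ((O₁.F (torusLift (2 * S + 1) V) : ℂ) + Complex.I * (O₂.F (torusLift (2 * S + 1) V) : ℂ))
                  ∂(wilsonMeasure (d := 4) (L := 2 * S + 1) r.ρ β')) *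
                (∫ V, ((O₁.F (torusLift (2 * S + 1) V) : ℂ) + Complex.I * (O₂.F (torusLift (2 * S + 1) V) : ℂ))
                  ∂(wilsonMeasure (d := 4) (L := 2 * S + 1) r.ρ β'))‖ ≤ D * Real.exp (-(M * n)) := by
  classical
  set Λ : Finset (Literature.MathematicalPhysics.QuantumLattice.ZdEdge 4) :=
    ((box 4 R).filter fun y => 1 ≤ y 0) ×ˢ (Finset.univ : Finset (Fin 4)) with hΛ
  set Λθ : Finset (Literature.MathematicalPhysics.QuantumLattice.ZdEdge 4) :=
    Λ.image (fun e => if e.2 = 0 then (latticeTimeReflection 4 (e.1 + Pi.single 0 1), 0)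
      else (latticeTimeReflection 4 e.1, e.2)) with hΛθ
  obtain ⟨K, hK0, hK⟩ := cscl_bs r hlock Λθ Λ
  set D : ℝ := 4 * K * Bb ^ 2 + 1 with hD
  have hD0 : 0 < D := by positivity
  -- `Nn`: `D e^{M} / εk ≤ e^{M Nn / 2}` for `Nn` large
  obtain ⟨Nn, hNmin, hNn⟩ : ∃ Nn : ℕ, Nmin ≤ Nn ∧ D * Real.exp M ≤ εk * Real.exp (M * Nn / 2) := by
    have ht : Tendsto (fun Nn : ℕ => εk * Real.exp (M * Nn / 2)) atTop atTop := by
      refine Tendsto.const_mul_atTop hεk (Real.tendsto_exp_atTop.comp ?_)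
      have : Tendsto (fun Nn : ℕ => M / 2 * (Nn : ℝ)) atTop atTop :=
        Tendsto.const_mul_atTop (by positivity) tendsto_natCast_atTop_atTop
      exact this.congr fun Nn => by ring
    obtain ⟨Nn, hNn⟩ := ((ht.eventually_ge_atTop (D * Real.exp M)).and (eventually_ge_atTop Nmin)).exists
    exact ⟨Nn, hNn.2, hNn.1⟩
  obtain ⟨L, hL𝓛, hL⟩ := hcof (2 * R + Nn + 10)
  refine ⟨L, hL𝓛, Nn, D, hNmin, hL, hD0, hNn, ?_⟩
  intro O₁ O₂ O₁' O₂' h1 h2 h1' h2' hF1 hF2 hB1 hB2 S hS n hn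
  have h := cscl_selfCorr_bound r hK0 hK O₁ O₂ O₁' O₂' h1 h2 h1' h2' hF1 hF2 hBb hB1 hB2 hS hn
  refine h.trans ?_
  have e0 : 0 ≤ Real.exp (-(M * n)) := (Real.exp_pos _).le
  nlinarith [e0]

end Budget

/-! ### The scheme -/

section Scheme

variable {G : Type} [Group G] [TopologicalSpace G] [IsTopologicalGroup G] [CompactSpace G]
  [MeasurableSpace G] [BorelSpace G] (r : LatticeRep G)

/-- **`a_k L_k → ∞`** from polynomial admissibility `a_k⁻¹ ≤ (a_k L_k)^N` (eventually, `N ≥ 1`) and `a_k → 0⁺`.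
[folklore] -/
theorem cscl_tendsto_mul_of_pow {a : ℕ → ℝ} {L : ℕ → ℕ} {N : ℕ} (hN : 1 ≤ N) (ha : ∀ k, 0 < a k)
    (ha0 : Tendsto a atTop (𝓝 0)) (hpow : ∀ᶠ k in atTop, (a k)⁻¹ ≤ (a k * (L k : ℝ)) ^ N) :
    Tendsto (fun k => a k * (L k : ℝ)) atTop atTop := by
  refine tendsto_atTop.2 fun b => ?_
  have hinv : Tendsto (fun k => (a k)⁻¹) atTop atTop :=
    Filter.Tendsto.inv_tendsto_nhdsGT_zero (tendsto_nhdsWithin_iff.2 ⟨ha0, Eventually.of_forall fun k => ha k⟩)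
  filter_upwards [hpow, hinv.eventually_ge_atTop ((max b 1) ^ N)] with k hk hk2
  have hx0 : 0 ≤ a k * (L k : ℝ) := mul_nonneg (ha k).le (Nat.cast_nonneg _)
  have h3 : (max b 1) ^ N ≤ (a k * (L k : ℝ)) ^ N := hk2.trans hk
  have h4 : max b 1 ≤ a k * (L k : ℝ) := le_of_pow_le_pow_left₀ (by omega) hx0 h3
  exact (le_max_left _ _).trans h4

/-- **The canonically normalised, exactly centred scheme with prescribed spacings, couplings and tori.** [folklore] -/
theorem cscl_mkScheme {a : ℕ → ℝ} (ha : ∀ k, 0 < a k) (ha0 : Tendsto a atTop (𝓝 0)) (βs : ℕ → ℝ) {L : ℕ → ℕ}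
    (hL : Tendsto (fun k => a k * (L k : ℝ)) atTop atTop) :
    ∃ sch : SpeciesScheme (YMSpecies G), (∀ k, sch.a k = a k) ∧ (∀ k, sch.β k = βs k) ∧ (∀ k, sch.L k = L k) ∧
      (∀ k : ℕ, sch.c r.curvature k = (sch.a k ^ 4)⁻¹) ∧
      (∀ k : ℕ, sch.m r.curvature k =
        ∫ U : GaugeConfig 4 (sch.side k) G, r.curvature.F (torusLift (sch.side k) U) ∂(wilsonMeasure r.ρ (sch.β k))) := by
  classical
  refine ⟨⟨a, ha, ha0, βs, L, hL, fun s k => if s = r.curvature then (a k ^ 4)⁻¹ else 0,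
    fun s k => if s = r.curvature then
      ∫ U : GaugeConfig 4 (2 * L k + 1) G, r.curvature.F (torusLift (2 * L k + 1) U) ∂(wilsonMeasure r.ρ (βs k))
      else 0⟩, fun _ => rfl, fun _ => rfl, fun _ => rfl, fun k => ?_, fun k => ?_⟩
  · simp
  · simp only [↓reduceIte]
    rfl

end Scheme

/-- **Registered anchor of this file** (closed form of `cscl_tendsto_mul_of_pow`, for the gate's `--supports` stub
check). [folklore] -/
theorem cscl_anchor_scheme :
    ∀ (a : ℕ → ℝ) (L : ℕ → ℕ) (N : ℕ), 1 ≤ N → (∀ k, 0 < a k) → Tendsto a atTop (𝓝 0) →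
      (∀ᶠ k in atTop, (a k)⁻¹ ≤ (a k * (L k : ℝ)) ^ N) → Tendsto (fun k => a k * (L k : ℝ)) atTop atTop :=
  fun _ _ _ hN ha ha0 hpow => cscl_tendsto_mul_of_pow hN ha ha0 hpow


end Summit.QuantumFields.YangMills.Theorems.ContinuumLegGivenGap

end
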